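/-
Origin: expansion seat `planner-pub-hodgecm-pv13-0`, handover 2026-08-18T03:58:36Z (`HOME/pub-hodgecm-pv13/lean/Pv13/SchurIsotypic.lean`, md5 a7302112, 151 lines);
landed by the gen-5 packager in gate run 20 as `HodgeCM/PerL34/SchurIsotypic.lean` (import ^import Pv[0-9]+\.→import HodgeCM.PerL34. ×1).
-/
/-
Origin: pub-hodgecm-pv13 (DAG-NODE PROVER #13), toward node N31h (ii) (PerL v5 ll. 633–635).  Imports this seat's
`Pv13.SchurConstituents` (→ `HodgeCM.PerL34.SchurConstituents` on landing) only.  Proposed place: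
`HodgeCM/PerL34/SchurIsotypic.lean`, namespace `HodgeCM.PerL34.Schur`.  Nothing cited, nothing asserted.
-/
import Summits.HodgeConjecture.HodgeCM.PerL34.SchurConstituents
import Mathlib.Analysis.InnerProductSpace.Projection.Submodule

set_option autoImplicit false

/-!
# The identification step `σ_b ≅ V_{χ̄′_b}` (kernel glue for N31h (ii), last piece)

With `SchurUnitary` (Schur) and `SchurConstituents` ("`V` occurs in every constituent of the closed span of the
lifts") the remaining Hilbert-space step of PerL v5 l. 633–635 is: if the archimedean component of a constituent
`σ` at `b` is `σ_b` — abstractly, `σ|_{G_b}` is topologically GENERATED by images of equivariant maps out of ONE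
irreducible `W = σ_b` — and `V = V_{χ̄′_b}` (irreducible) maps non-trivially and equivariantly into `σ`, then
`V ≅ W`.  THEOREM `exists_equiv_of_intertwiner_into_generated`: `τ` unitary on `H`, `ρ` irreducible on `V`,
`σ_W` irreducible on `W`, bounded intertwiners `e_i : W → H` with dense total range, a non-zero bounded
intertwiner `T : V → H` ⇒ an equivariant `V ≃ₗᵢ[ℂ] W`.  Proof: some `e_i† ∘ T ≠ 0` (else `T(V) ⊥ ⋃ e_i(W)`, dense),
and `e_i† ∘ T` is a `(ρ, σ_W)`-intertwiner between irreducibles (adjoints of intertwiners of UNITARY representations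
intertwine), so Schur's equivalence form applies.
-/

noncomputable section

open scoped InnerProductSpace ComplexConjugate
open ContinuousLinearMap

namespace HodgeCM
namespace PerL34
namespace Schur

variable {G : Type*} [Group G]
variable {H : Type*} [NormedAddCommGroup H] [InnerProductSpace ℂ H] [CompleteSpace H]
variable {V : Type*} [NormedAddCommGroup V] [InnerProductSpace ℂ V] [CompleteSpace V]
variable {W : Type*} [NormedAddCommGroup W] [InnerProductSpace ℂ W] [CompleteSpace W]
variable {ρ : G →* unitary (V →L[ℂ] V)} {τ : G →* unitary (H →L[ℂ] H)} {σ : G →* unitary (W →L[ℂ] W)}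

/-- Intertwiners compose. -/
theorem Intertwines.comp {T : V →L[ℂ] H} {S : H →L[ℂ] W} (hT : Intertwines ρ τ T) (hS : Intertwines τ σ S) :
    Intertwines ρ σ (S ∘L T) := by
  intro g
  rw [comp_assoc, hT g, ← comp_assoc, hS g, comp_assoc]

omit [CompleteSpace V] in
/-- If bounded maps `e_i : W → H` have dense total range and `e_i† (T x) = 0` for all `i`, `x`, then `T = 0`. -/
theorem eq_zero_of_adjoint_comp_eq_zero {ι : Type*} (e : ι → (W →L[ℂ] H))
    (hdense : (⨆ i, LinearMap.range (e i).toLinearMap).topologicalClosure = ⊤) (T : V →L[ℂ] H)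
    (h : ∀ i, adjoint (e i) ∘L T = 0) : T = 0 := by
  have hbot : (⨆ i, LinearMap.range (e i).toLinearMap)ᗮ = ⊥ :=
    Submodule.topologicalClosure_eq_top_iff.mp hdense
  ext x
  have hx : T x ∈ (⨆ i, LinearMap.range (e i).toLinearMap)ᗮ := by
    rw [← Submodule.iInf_orthogonal, Submodule.mem_iInf]
    intro i
    rw [Submodule.mem_orthogonal]
    rintro _ ⟨w, rfl⟩
    change ⟪e i w, T x⟫_ℂ = 0
    rw [← adjoint_inner_right]
    have h0 : adjoint (e i) (T x) = 0 := by
      have := congrArg (fun S : V →L[ℂ] W => S x) (h i)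
      simpa using this
    rw [h0, inner_zero_right]
  rw [hbot, Submodule.mem_bot] at hx
  simpa using hx

/-- **Identification of the local component.**  `τ` unitary on `H` topologically generated by the images of
`(σ, τ)`-intertwiners `e_i : W → H` out of ONE irreducible `σ` ("`H` is `σ`-isotypic"); `ρ` irreducible with a non-zero
`(ρ, τ)`-intertwiner `T : V → H`.  Then `ρ ≅ σ`: there is an equivariant isometric isomorphism `V ≃ₗᵢ[ℂ] W`, a positive
multiple of `e_i† ∘ T` for some `i`. -/
theorem exists_equiv_of_intertwiner_into_generated (hρ : Irreducible ρ) (hσ : Irreducible σ) {ι : Type*}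
    (e : ι → (W →L[ℂ] H)) (he : ∀ i, Intertwines σ τ (e i))
    (hdense : (⨆ i, LinearMap.range (e i).toLinearMap).topologicalClosure = ⊤)
    {T : V →L[ℂ] H} (hT : Intertwines ρ τ T) (hT0 : T ≠ 0) :
    ∃ (i : ι) (U : V ≃ₗᵢ[ℂ] W), (∃ a : ℝ, 0 < a ∧ ∀ x, U x = (a : ℂ) • adjoint (e i) (T x)) ∧
      ∀ (g : G) (x : V), U ((ρ g : V →L[ℂ] V) x) = (σ g : W →L[ℂ] W) (U x) := by
  have hex : ∃ i, adjoint (e i) ∘L T ≠ 0 := by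
    by_contra hall
    push Not at hall
    exact hT0 (eq_zero_of_adjoint_comp_eq_zero e hdense T hall)
  obtain ⟨i, hi⟩ := hex
  have hTi : Intertwines ρ σ (adjoint (e i) ∘L T) := hT.comp (he i).adjoint_intertwines
  obtain ⟨U, ⟨a, ha, hUa⟩, hU⟩ := exists_equiv_of_intertwiner_ne_zero hρ hσ hTi hi
  exact ⟨i, U, ⟨a, ha, fun x => by rw [hUa x]; rfl⟩, hU⟩

/-- **The abstract constituent theorem of N31h (ii)** (all three kernel pieces together).  `τ` unitary on `H`;
`ρ` irreducible on `V` with `(ρ, τ)`-intertwiners `θ_j : V → H` ("the lifts"); `K` a non-zero closed `τ`-invariant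
subspace of the closed span of `⋃_j θ_j(V)` ("a constituent of the closure of `π_i`, restricted to `G_b`"); `σ`
irreducible on `W` with `(σ, τ)`-intertwiners `e_i : W → H` whose closed total range contains `K` (e.g. they land
in `K` with dense total range: "`K|_{G_b}` is `σ_b`-isotypic").  Then `ρ ≅ σ` equivariantly and isometrically ("`σ_b ≅ V_{χ̄′_b}`"). -/
theorem local_component_of_constituent (hρ : Irreducible ρ) (hσ : Irreducible σ) {ι κ : Type*}
    (θ : κ → (V →L[ℂ] H)) (hθ : ∀ j, Intertwines ρ τ (θ j)) (K : Submodule ℂ H)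
    (hKc : IsClosed (K : Set H)) (hKinv : Invariant (ops τ) K) (hK0 : K ≠ ⊥)
    (hKle : K ≤ (⨆ j, LinearMap.range (θ j).toLinearMap).topologicalClosure)
    (e : ι → (W →L[ℂ] H)) (he : ∀ i, Intertwines σ τ (e i))
    (hdense : K ≤ (⨆ i, LinearMap.range (e i).toLinearMap).topologicalClosure) :
    ∃ U : V ≃ₗᵢ[ℂ] W, ∀ (g : G) (x : V), U ((ρ g : V →L[ℂ] V) x) = (σ g : W →L[ℂ] W) (U x) := by
  haveI : CompleteSpace K := hKc.completeSpace_coe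
  -- Step 1 (SchurConstituents): an equivariant isometry `U₁ : V → H` with values in `K`.
  obtain ⟨j, U₁, hmem, -, -, hU₁, -⟩ := exists_isometry_into_of_le_closure_span hρ θ hθ K hKc hKinv hK0 hKle
  let T : V →L[ℂ] H := U₁.toContinuousLinearMap
  have hT : Intertwines ρ τ T := by
    intro g
    ext x
    exact hU₁ g x
  -- Step 2: some `e_i† ∘ T ≠ 0` — else `T(V) ⊥ ⋃ e_i(W)`, which is dense in `K ∋ T x`, so `T = 0`, so `V = 0`
  -- (T is isometric), so the closed span of the `θ_j(V)` is `⊥`, contradicting `K ≠ ⊥`.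
  have hex : ∃ i, adjoint (e i) ∘L T ≠ 0 := by
    by_contra hall
    push Not at hall
    have hV : ∀ x : V, x = 0 := by
      intro x
      have hTx : T x ∈ (⨆ i, LinearMap.range (e i).toLinearMap)ᗮ := by
        rw [← Submodule.iInf_orthogonal, Submodule.mem_iInf]
        intro i
        rw [Submodule.mem_orthogonal]
        rintro _ ⟨w, rfl⟩
        change ⟪e i w, T x⟫_ℂ = 0
        rw [← adjoint_inner_right]
        have h0 : adjoint (e i) (T x) = 0 := by
          have := congrArg (fun S : V →L[ℂ] W => S x) (hall i)
          simpa using this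
        rw [h0, inner_zero_right]
      have hTxK : T x ∈ (⨆ i, LinearMap.range (e i).toLinearMap).topologicalClosure := hdense (hmem x)
      have horth : ⟪T x, T x⟫_ℂ = 0 := by
        rw [← Submodule.orthogonal_orthogonal_eq_closure] at hTxK
        exact (Submodule.mem_orthogonal _ _).mp hTxK _ hTx
      have hTx0 : T x = 0 := inner_self_eq_zero.mp horth
      have h1 : ‖T x‖ = ‖x‖ := U₁.norm_map x
      rw [hTx0, norm_zero] at h1
      exact norm_eq_zero.mp h1.symm
    apply hK0
    rw [eq_bot_iff]
    refine hKle.trans (Submodule.topologicalClosure_minimal _ ?_ ?_)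
    · refine iSup_le fun j' => ?_
      rintro _ ⟨x, rfl⟩
      rw [hV x, map_zero]
      exact Submodule.zero_mem _
    · rw [Submodule.bot_coe]
      exact isClosed_singleton
  obtain ⟨i, hi⟩ := hex
  have hTi : Intertwines ρ σ (adjoint (e i) ∘L T) := hT.comp (he i).adjoint_intertwines
  obtain ⟨U, -, hU⟩ := exists_equiv_of_intertwiner_ne_zero hρ hσ hTi hi
  exact ⟨U, hU⟩

end Schur
end PerL34
end HodgeCM

end
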